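import Summits.FinalStateConjecture.FinalStateConjecture.Theses.ZeroEnergyKerrOrBomb
import Summits.FinalStateConjecture.FinalStateConjecture.Theses.BeltLiouville
import Summits.FinalStateConjecture.FinalStateConjecture.Theorems.ZeroEnergyRigidity.Negative.KerrParameterSign
import Summits.FinalStateConjecture.FinalStateConjecture.Theorems.ZeroEnergyRigidity.Negative.KillingNonvanishingOfGH
import Summits.FinalStateConjecture.FinalStateConjecture.Theorems.ZeroEnergyRigidity.Negative.HorizonKillingScaling
import Literature.Geometry.Lorentzian.AxisymmetricBlackHoleUniqueness
import Literature.Geometry.Lorentzian.IPlusRegular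

/-!
# Line `zero-frequency-pohozaev-pair` for crux `ZeroEnergyRigidity` (stmt-FinalStateConjecture-10690)

Crux-plan seat `planner-cruxplan-stmt-FinalStateConjecture-10690-zero-frequency-pohoz-0`, 2026-08-16.
Line card: `Lines/zero-frequency-pohozaev-pair.md` (same directory).

## VERDICT FOR THE TYPED DECL: no concluding skeleton (`no-skeleton`), for a reason made precise below

The idea's lever is an ENGINE for the Hawking/Killing-extension step through the ergoregion: a
*Pohozaev pair* `(b, α)` — a `T`-invariant vector field `b` and a constant `α > 0` with
`½𝓛_b a − α a ≺ 0` on `T⁰`, `a = √|g| g♯|_{T⁰}` the `T`-reduced principal symbol density — turns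
the weight-free multiplier identity `(bψ + αψ)·Pψ = div(…) + [½𝓛_b a − αa](dψ,dψ)` into a
Liouville theorem for `T`-invariant, compactly-supported-mod-`T` zero-frequency objects (scalar
model: exact; Kerr certificate `b = −∂_r`, `0 < α < M/a²`, TRIAGE-r1-1/2 closed form).  Its ONLY
geometric input is ZERO-ENERGY NON-TRAPPING MOD `T` (from which the pair is to be built, stub
`stub_pairFromNonTrapping`).

The typed decl `ZeroEnergyKerrOrBomb.ZeroEnergyRigidity` carries NO such input: its hypothesis h6
("every zero-energy null ray on `[0,∞)` leaves every compact `K ⊆ doc`", compact IN SPACETIME) is a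
theorem of h4 `IsGloballyHyperbolic` (non-imprisonment; `Disproof.zeroEnergyRigidity_iff_fullRigidityGH`,
six refuter notes 2026-08-15) and is in any case weaker than non-trapping mod `T` (a ray confined to
the non-compact `T`-orbit of a compact set does not offend h6).  So, modulo non-imprisonment, the
typed decl is `Disproof.CoreRigidityGH` — UNCONDITIONAL smooth stationary vacuum uniqueness with a
GLOBAL horizon Killing field (h3, `Disproof.exists_global_killing_of_H3`) and WITHOUT
`I⁺`-regularity.  Consequently every composition `stub₁ → … → stubₖ → ZeroEnergyRigidity` built
from THIS line's stubs must contain a stub of the shape `TypedTelescopeGap` below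
(`zeroEnergyRigidity_of_gap` is the kernel-checked witness of that reduction), whose conjunct
"h1–h4 ⇒ no zero-energy null geodesic trapped mod `T`" is the conclusion's shadow (true iff
uniqueness; no independent mechanism — Ionescu–Klainerman's normalisation test `T ↦ T + cΦ`,
barrier `IonescuKlainermanNonExtension` scope caveat (g), shows local vacuum structure does not
decide it) — a COSTUME in the sense of D-0027 §3.2 (3) — and whose conjunct "h1–h4 ⇒
`IsIPlusRegular`" is FALSE as a `∀`-statement (Disproof F7(i); TRIAGE-r1-3 F-A: carved Kerr
presentations `I⁻(T·p₀) ∩ {r > r₀}` satisfy h1–h6 with non-compact horizon sections).  Moreover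
h3's GLOBAL Killing field pre-empts the very extension step where the pair would act (TRIAGE-r1-1
D-h3).  Hence: no `ZeroEnergyRigidity_of`; the three triagers' unanimous advice ("pursue by sharing
BeltLiouville's crux; every card presupposes the restate") is followed instead.

## WHAT THIS FILE DELIVERS (checked: `lean check` rc 0, `sorry` only inside `stub_*`)

* § 1  `stub_pairFromNonTrapping` (G1, geometry: non-trapping inside `orbit_T(S)` ⇒ an escape
  Pohozaev pair on `orbit_T(S)`) and `stub_pairKillingLiouville` (G2, the ENGINE and the hardest
  stub: a pair on `orbit_T(S)` ⇒ the belt Killing–Liouville property — `BeltKillingLiouville` with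
  its non-trapping clause REPLACED by the pair), stated over existing declarations only.
* § 2  BY-NAME docking into the SHARED Hawking step: `beltKillingLiouville_of : § 1 ⇒
  BeltLiouville.BeltKillingLiouville` (crux stmt-FinalStateConjecture-10442) and, with the shared
  item `stub_beltReduction = BeltLiouville.BeltReduction` (stmt-10443),
  `smoothHawkingRigidity_of : … ⇒ BeltLiouville.SmoothHawkingRigidity` (stmt-10441 ≡ AIE's
  stmt-13896 in content).  Real proofs, no `sorry`.
* § 3  The RESTATED crux this line (and, per the triage, every surviving card) presupposes —
  `ZeroEnergyRigidityRestated` := BeltLiouville's telescope (collar-local h3 with `[T,K] = 0`,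
  `κ ≠ 0`; `π₁(doc) = 0`; d.o.c. compact mod `T`; non-trapping MOD THE FLOW verbatim = Disproof
  F5's C‴) + `IsIPlusRegular` (Disproof F7(i) / TRIAGE F-A) ⇒ the crux conclusion VERBATIM
  (fact-free Kerr chart form) — with the dock-frame stub `stub_axisymmetricEndgame` (CCH12 +
  Beig–Chruściel + chart transfer, shared with card dock-hawking-step-shared-crux (T3)) and the
  real composition `zeroEnergyRigidityRestated_of` (4 stubs).  If the route planner files the
  restate with this body, `zeroEnergyRigidityRestated_of` IS the registrable `<Crux>_of`.
* § 4  `TypedTelescopeGap` and `zeroEnergyRigidity_of_gap : TypedTelescopeGap →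
  ZeroEnergyRigidityRestated → ZeroEnergyRigidity` — the exact residue separating the line from the
  typed decl (documented FALSE/circular conjunct by conjunct; deliberately a `def`, NOT a stub).
* § 5  Litmus statements for the lead's first hour (defs, no `sorry`): the exact scalar Liouville
  (`ScalarPairLiouville`, the card's first lemma) and its lower-order-perturbed version
  (`ScalarPairLiouvilleWithLowerOrder`, the cheapest falsifier of G2).

Disproof.lean used (rev of 2026-08-16T02:25Z): F2/F8 (typed ≡ Core: the reason for § 4), F3
(global K), F5 (C‴ mod-flow clause verbatim — § 3 uses BeltLiouville's letter-identical clause),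
F7(i)(iii) (I⁺-regularity as HYPOTHESIS; every stub lives on `doc ∪ horizon ∪ M_ext`), F9/F11 (κ
carries one bit; stubs 3–4 ask only `κ ≠ 0`, invariant under `κ ↦ cκ`; orientation is
BeltReduction's internal lemma), F10 (normalisation of `T` is free: no stub identifies `T` with
`∂_{t*}` or uses `Ω_H`, `κ` as numbers; stub 4 concludes the `T`-free chart form), (b′) tightness.
The three LANDED Negative modules are imported (`KerrParameterSign`, `KillingNonvanishingOfGH`,
`HorizonKillingScaling`) and no stub is an instance they refute (conclusion verbatim with `∃ (M a)`,
no sign of `a` fixed, no `∃!`; no h5-type hypothesis; `κ ≠ 0` only).  No `_false_without_` theorem is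
claimed conclusive in Disproof (all three are sorried near-misses); § 3 keeps h1 (vacuum), h2
(connected horizon), h4-type global structure (`IsIPlusRegular` ⊇ GH of doc), honouring them anyway.

Sibling line on this crux: `Lines/global-horizon-killing-field.lean` (typing lever, concludes the
TYPED decl by name via an `I⁺`-regular re-presentation of the d.o.c.; it needs no Hawking step
because h3's `K` is global) — the right line for the decl AS TYPED; this file is the engine line for
the decl AS INTENDED (restated) and for the shared Hawking step.
-/

noncomputable section

set_option linter.dupNamespace false

namespace Summit.FinalStateConjecture.FinalStateConjecture.Cruxes.ZeroEnergyRigidity.ZeroFrequencyPohozaevPair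

open scoped Manifold ContDiff Topology
open Set Literature.Geometry.Lorentzian
open Summit.FinalStateConjecture.FinalStateConjecture.Theses

/-! ## § 0  Vocabulary (documentation only — the stubs below INLINE these predicates so that a
prover's `--supports` file never has to import this work file) -/

/-- **Escape Pohozaev pair on `A ⊆ 𝓑`** (readable form of the block inlined in the stubs).
`b` is a smooth `T`-invariant vector field on the d.o.c., `f` a smooth `T`-invariant function,
`α > 0` a constant, such that on `A`:
* (escape) `df(b) < 0` — `f` strictly decreases along `b`, so `b ≠ 0` on `A` and `b`-lines leave
  every compact-mod-`T` part of `A` (this is the (P⁺) strengthening TRIAGE-r1-3 asks for: it is what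
  lets the transport half of the Ionescu–Klainerman system be integrated along `b`);
* (Pohozaev) for every `v ≠ 0` with `g(v, T) = 0`:
  `(½ div_g b − α) g(v,v) − g(∇_v b, v) < 0`, where `div_g b = tr (v ↦ ∇_v b)`.
The second clause is EXACTLY negative-definiteness on `T⁰` of `½𝓛_b a − α a`,
`a = √|g| g♯|_{T⁰}`: for `ξ ∈ T⁰`, `v = ξ♯`, `(𝓛_b(√|g| g♯))(ξ,ξ) = √|g|[(div_g b) g(v,v) − 2 g(∇_v b, v)]`
(derived in the line card; independent of the `T`-component of `b`, as it must be).  On Kerr,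
`b = −∂_r` (Boyer–Lindquist, away from `r₊`), `f = r`, `0 < α < M/a²` is such a pair on the whole
exterior (card certificate; TRIAGE-r1-1 closed form `α < f_min(a)`, `f_min a²/M ∈ (3√3/2, 4)`). -/
def IsEscapePair (𝓑 : StationaryAFBlackHole.{0}) [𝓑.metric.HasLeviCivita]
    (A : Set 𝓑.carrier) (b : Π x : 𝓑.carrier, TangentSpace (𝓡 4) x) (α : ℝ)
    (f : 𝓑.carrier → ℝ) : Prop :=
  ContMDiffOn (𝓡 4) ((𝓡 4).prod 𝓘(ℝ, E4)) ∞
      (fun x ↦ (Bundle.TotalSpace.mk' E4 x (b x) : TangentBundle (𝓡 4) 𝓑.carrier)) 𝓑.doc ∧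
    (∀ x ∈ 𝓑.doc, VectorField.mlieBracket (𝓡 4) 𝓑.killing b x = 0) ∧
    ContMDiffOn (𝓡 4) 𝓘(ℝ, ℝ) ∞ f 𝓑.doc ∧
    (∀ x ∈ 𝓑.doc, mfderiv (𝓡 4) 𝓘(ℝ, ℝ) f x (𝓑.killing x) = 0) ∧
    0 < α ∧
    (∀ x ∈ A, (show ℝ from mfderiv (𝓡 4) 𝓘(ℝ, ℝ) f x (b x)) < 0) ∧
    ∀ x ∈ A, ∀ v : TangentSpace (𝓡 4) x, 𝓑.metric.val x v (𝓑.killing x) = 0 → v ≠ 0 →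
      (1 / 2 * LinearMap.trace ℝ (TangentSpace (𝓡 4) x) (𝓑.metric.leviCivita b x).toLinearMap - α)
          * 𝓑.metric.val x v v - 𝓑.metric.val x (𝓑.metric.leviCivita b x v) v < 0

/-- **No zero-energy null geodesic inside `orbit_T(S)`** — verbatim the clause of
`BeltLiouville.BeltKillingLiouville` (and, quantified over all compact `S ⊆ doc`, the non-trapping
MOD THE FLOW clause of `BeltLiouville.SmoothHawkingRigidity` / `AnalyticityInvadesErgoregion.
NonTrappingHawkingRigidity` / Disproof F5's C‴ = `¬ HasZeroEnergyRayTrappedModFlow` unfolded). -/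
def NoZeroEnergyGeodesicInOrbit (𝓑 : StationaryAFBlackHole.{0}) [𝓑.metric.HasLeviCivita]
    (S : Set 𝓑.carrier) : Prop :=
  ∀ (γ : ℝ → 𝓑.carrier) (s : Set ℝ),
    IsMaximalGeodesicOn 𝓑.metric.toPseudoRiemannianMetric.leviCivita γ s → s.Nonempty →
      (∀ t ∈ s, 𝓑.metric.val (γ t) (velocity (𝓡 4) γ t) (velocity (𝓡 4) γ t) = 0 ∧
        velocity (𝓡 4) γ t ≠ 0 ∧
          𝓑.metric.val (γ t) (velocity (𝓡 4) γ t) (𝓑.killing (γ t)) = 0) →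
      ∃ t ∈ s, γ t ∉ stationaryOrbit 𝓑.killing S

/-! ## § 1  The two stubs of the line proper -/

/-- **stub 1 — `stub_pairFromNonTrapping` (G1; geometry; the idea's Transfer).**  For a vacuum
stationary AF black hole and a compact `S ⊆ doc` inside whose `T`-orbit NO maximal zero-energy null
geodesic lies, there is an escape Pohozaev pair `(b, α, f)` on `orbit_T(S)` (block = `IsEscapePair 𝓑
(stationaryOrbit 𝓑.killing S) b α f` inlined).
Why plausibly true: a strict `T`-null-convex exhaustion `φ` of the belt gives one with
`b = −μ(φ)∇φ`, `μ′ ≪ 0` handling the transversal null directions and Finsler's lemma the off-cone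
part (TRIAGE-r1-3), so the stub is WEAKER than the route's planned child `ExhaustionFromNoTrapping`;
Kerr carries a pair for all `|a| < M`.
Why it might fail: fibre-LINEAR escape functions are strictly stronger than non-trapping in general
2+1 optics — Hahn–Banach dual obstruction = `T`-invariant PSD divergence-free `a`-null tensor
measures ("null dust"), a larger class than invariant measures on trapped rays (TRIAGE-r1-1 G1,
r1-2 G1); vacuum/AF structure of the belt must be what excludes it.  Size: XL (open).
Sources: arXiv:1501.01587 §4; card zero-frequency-pohozaev-pair; TRIAGE-r1-1/2/3. -/
theorem stub_pairFromNonTrapping :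
    ∀ (𝓑 : StationaryAFBlackHole.{0}) [𝓑.metric.HasLeviCivita],
      𝓑.metric.toPseudoRiemannianMetric.IsRicciFlat →
      ∀ (S : Set 𝓑.carrier), IsCompact S → S ⊆ 𝓑.doc →
      (∀ (γ : ℝ → 𝓑.carrier) (s : Set ℝ),
        IsMaximalGeodesicOn 𝓑.metric.toPseudoRiemannianMetric.leviCivita γ s → s.Nonempty →
          (∀ t ∈ s, 𝓑.metric.val (γ t) (velocity (𝓡 4) γ t) (velocity (𝓡 4) γ t) = 0 ∧
            velocity (𝓡 4) γ t ≠ 0 ∧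
              𝓑.metric.val (γ t) (velocity (𝓡 4) γ t) (𝓑.killing (γ t)) = 0) →
          ∃ t ∈ s, γ t ∉ stationaryOrbit 𝓑.killing S) →
      ∃ (b : Π x : 𝓑.carrier, TangentSpace (𝓡 4) x) (α : ℝ) (f : 𝓑.carrier → ℝ),
        ContMDiffOn (𝓡 4) ((𝓡 4).prod 𝓘(ℝ, E4)) ∞
            (fun x ↦ (Bundle.TotalSpace.mk' E4 x (b x) : TangentBundle (𝓡 4) 𝓑.carrier)) 𝓑.doc ∧
        (∀ x ∈ 𝓑.doc, VectorField.mlieBracket (𝓡 4) 𝓑.killing b x = 0) ∧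
        ContMDiffOn (𝓡 4) 𝓘(ℝ, ℝ) ∞ f 𝓑.doc ∧
        (∀ x ∈ 𝓑.doc, mfderiv (𝓡 4) 𝓘(ℝ, ℝ) f x (𝓑.killing x) = 0) ∧
        0 < α ∧
        (∀ x ∈ stationaryOrbit 𝓑.killing S, (show ℝ from mfderiv (𝓡 4) 𝓘(ℝ, ℝ) f x (b x)) < 0) ∧
        ∀ x ∈ stationaryOrbit 𝓑.killing S, ∀ v : TangentSpace (𝓡 4) x,
          𝓑.metric.val x v (𝓑.killing x) = 0 → v ≠ 0 →
            (1 / 2 * LinearMap.trace ℝ (TangentSpace (𝓡 4) x) (𝓑.metric.leviCivita b x).toLinearMap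
                - α) * 𝓑.metric.val x v v - 𝓑.metric.val x (𝓑.metric.leviCivita b x v) v < 0 := by
  sorry

/-- **stub 2 — `stub_pairKillingLiouville` (G2; the ENGINE; HARDEST).**  `BeltKillingLiouville`
with its non-trapping clause REPLACED by an escape Pohozaev pair on `orbit_T(S)`: for a vacuum 𝓑 with
simply connected d.o.c., compact `S ⊆ doc`, `R' ≥ e.R + 1` with `orbit_T(S)` disjoint from
`orbit_T(embed (far R'))`, and a pair `(b, α, f)` on `orbit_T(S)`, every `Z` smooth on doc with
`[T, Z] = 0` and Killing on `doc ∖ orbit_T(S)` admits `Z'` smooth and Killing on doc with `Z' = Z`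
on `orbit_T(embed (far R'))`.
Intended proof (the card's mechanism): `w := 𝓛_Z g` is an exact, `T`-stationary linearised vacuum
solution supported in the belt; run the Ionescu–Klainerman variables `(W = 𝓛_Z R; π = w, ∇π)`:
the wave part `□_g W = R⋆W + R⋆∇²π + ∇R⋆∇π + ∇²R⋆π` is hit with the multiplier `b·∇W + αW`, whose
bulk is `[½𝓛_b a − αa](dW,dW) ≺ 0` (weight-free, blind to the ergosurface), the transport part is
integrated along `b`-lines using `df(b) < 0` (escape); closing gives `W = 0`, `π` pure gauge
`𝓛_X g` with `X → 0` at infinity, `Z' := Z − X`.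
Why it might fail (the load-bearing doubt of all three triagers): the cross terms
`∫(b·∇W + αW)(curvature ⋆ π, ∇π)` are UNSIGNED and there is no large parameter to absorb them ("no
Carleman" is precisely that loss); Grönwall along `b` costs `exp(belt width)`; no multiplier proof of
`ω = 0` rigidity is known even for linearised gravity on EXACT Kerr (Teukolsky–Starobinsky/Whiting
transformations, not virials).  First thing to settle: `ScalarPairLiouvilleWithLowerOrder` (§ 5).
Fallback if it dies: gradient pairs `b = −μ∇φ` ARE `T`-pseudo-convex weights ⇒ AIK Carleman sweep
(merge into the route's planned child `CarlemanSweep`).  Size: XL.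
Sources: IonescuKlainerman2009 (arXiv:0711.0040) §§2–3, AlexakisIonescuKlainerman2009, arXiv:1608.02035
(Moschidis: vector-field Carleman outside the ergoregion), BeltLiouville.lean (stmt-10442 docstring),
TRIAGE-r1-1 G2 / r1-2 G2 / r1-3 G2. -/
theorem stub_pairKillingLiouville :
    ∀ (𝓑 : StationaryAFBlackHole.{0}) [𝓑.metric.HasLeviCivita],
      𝓑.metric.toPseudoRiemannianMetric.IsRicciFlat → SimplyConnectedSpace 𝓑.doc →
      ∀ (S : Set 𝓑.carrier) (R' : ℝ), IsCompact S → S ⊆ 𝓑.doc → 𝓑.e.R + 1 ≤ R' →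
      Disjoint (stationaryOrbit 𝓑.killing S) (stationaryOrbit 𝓑.killing (𝓑.embed '' 𝓑.e.far R')) →
      (∃ (b : Π x : 𝓑.carrier, TangentSpace (𝓡 4) x) (α : ℝ) (f : 𝓑.carrier → ℝ),
        ContMDiffOn (𝓡 4) ((𝓡 4).prod 𝓘(ℝ, E4)) ∞
            (fun x ↦ (Bundle.TotalSpace.mk' E4 x (b x) : TangentBundle (𝓡 4) 𝓑.carrier)) 𝓑.doc ∧
        (∀ x ∈ 𝓑.doc, VectorField.mlieBracket (𝓡 4) 𝓑.killing b x = 0) ∧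
        ContMDiffOn (𝓡 4) 𝓘(ℝ, ℝ) ∞ f 𝓑.doc ∧
        (∀ x ∈ 𝓑.doc, mfderiv (𝓡 4) 𝓘(ℝ, ℝ) f x (𝓑.killing x) = 0) ∧
        0 < α ∧
        (∀ x ∈ stationaryOrbit 𝓑.killing S, (show ℝ from mfderiv (𝓡 4) 𝓘(ℝ, ℝ) f x (b x)) < 0) ∧
        ∀ x ∈ stationaryOrbit 𝓑.killing S, ∀ v : TangentSpace (𝓡 4) x,
          𝓑.metric.val x v (𝓑.killing x) = 0 → v ≠ 0 →
            (1 / 2 * LinearMap.trace ℝ (TangentSpace (𝓡 4) x) (𝓑.metric.leviCivita b x).toLinearMap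
                - α) * 𝓑.metric.val x v v - 𝓑.metric.val x (𝓑.metric.leviCivita b x v) v < 0) →
      ∀ Z : Π x : 𝓑.carrier, TangentSpace (𝓡 4) x,
        ContMDiffOn (𝓡 4) ((𝓡 4).prod 𝓘(ℝ, E4)) ∞
            (fun x ↦ (Bundle.TotalSpace.mk' E4 x (Z x) : TangentBundle (𝓡 4) 𝓑.carrier)) 𝓑.doc →
        (∀ x ∈ 𝓑.doc, VectorField.mlieBracket (𝓡 4) 𝓑.killing Z x = 0) →
        (∀ x ∈ 𝓑.doc, x ∉ stationaryOrbit 𝓑.killing S → ∀ v w : TangentSpace (𝓡 4) x,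
          𝓑.metric.val x (𝓑.metric.leviCivita Z x v) w +
            𝓑.metric.val x v (𝓑.metric.leviCivita Z x w) = 0) →
        ∃ Z' : Π x : 𝓑.carrier, TangentSpace (𝓡 4) x,
          ContMDiffOn (𝓡 4) ((𝓡 4).prod 𝓘(ℝ, E4)) ∞
              (fun x ↦ (Bundle.TotalSpace.mk' E4 x (Z' x) : TangentBundle (𝓡 4) 𝓑.carrier)) 𝓑.doc ∧
          (∀ x ∈ 𝓑.doc, ∀ v w : TangentSpace (𝓡 4) x,
            𝓑.metric.val x (𝓑.metric.leviCivita Z' x v) w +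
              𝓑.metric.val x v (𝓑.metric.leviCivita Z' x w) = 0) ∧
          ∀ x ∈ stationaryOrbit 𝓑.killing (𝓑.embed '' 𝓑.e.far R'), Z' x = Z x := by
  sorry

/-! ## § 2  By-name docking into the shared Hawking step (`BeltLiouville`, crux stmt-10442 / target stmt-10441) -/

/-- **The line proves `BeltKillingLiouville` (crux stmt-FinalStateConjecture-10442) BY NAME**:
geometry (stub 1) supplies the pair on `orbit_T(S)` from the item's own non-trapping clause, the
engine (stub 2) does the rest.  Real proof (pure logic). -/
theorem beltKillingLiouville_of
    (h₁ : ∀ (𝓑 : StationaryAFBlackHole.{0}) [𝓑.metric.HasLeviCivita],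
      𝓑.metric.toPseudoRiemannianMetric.IsRicciFlat →
      ∀ (S : Set 𝓑.carrier), IsCompact S → S ⊆ 𝓑.doc →
      (∀ (γ : ℝ → 𝓑.carrier) (s : Set ℝ),
        IsMaximalGeodesicOn 𝓑.metric.toPseudoRiemannianMetric.leviCivita γ s → s.Nonempty →
          (∀ t ∈ s, 𝓑.metric.val (γ t) (velocity (𝓡 4) γ t) (velocity (𝓡 4) γ t) = 0 ∧
            velocity (𝓡 4) γ t ≠ 0 ∧
              𝓑.metric.val (γ t) (velocity (𝓡 4) γ t) (𝓑.killing (γ t)) = 0) →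
          ∃ t ∈ s, γ t ∉ stationaryOrbit 𝓑.killing S) →
      ∃ (b : Π x : 𝓑.carrier, TangentSpace (𝓡 4) x) (α : ℝ) (f : 𝓑.carrier → ℝ),
        ContMDiffOn (𝓡 4) ((𝓡 4).prod 𝓘(ℝ, E4)) ∞
            (fun x ↦ (Bundle.TotalSpace.mk' E4 x (b x) : TangentBundle (𝓡 4) 𝓑.carrier)) 𝓑.doc ∧
        (∀ x ∈ 𝓑.doc, VectorField.mlieBracket (𝓡 4) 𝓑.killing b x = 0) ∧
        ContMDiffOn (𝓡 4) 𝓘(ℝ, ℝ) ∞ f 𝓑.doc ∧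
        (∀ x ∈ 𝓑.doc, mfderiv (𝓡 4) 𝓘(ℝ, ℝ) f x (𝓑.killing x) = 0) ∧
        0 < α ∧
        (∀ x ∈ stationaryOrbit 𝓑.killing S, (show ℝ from mfderiv (𝓡 4) 𝓘(ℝ, ℝ) f x (b x)) < 0) ∧
        ∀ x ∈ stationaryOrbit 𝓑.killing S, ∀ v : TangentSpace (𝓡 4) x,
          𝓑.metric.val x v (𝓑.killing x) = 0 → v ≠ 0 →
            (1 / 2 * LinearMap.trace ℝ (TangentSpace (𝓡 4) x) (𝓑.metric.leviCivita b x).toLinearMap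
                - α) * 𝓑.metric.val x v v - 𝓑.metric.val x (𝓑.metric.leviCivita b x v) v < 0)
    (h₂ : ∀ (𝓑 : StationaryAFBlackHole.{0}) [𝓑.metric.HasLeviCivita],
      𝓑.metric.toPseudoRiemannianMetric.IsRicciFlat → SimplyConnectedSpace 𝓑.doc →
      ∀ (S : Set 𝓑.carrier) (R' : ℝ), IsCompact S → S ⊆ 𝓑.doc → 𝓑.e.R + 1 ≤ R' →
      Disjoint (stationaryOrbit 𝓑.killing S) (stationaryOrbit 𝓑.killing (𝓑.embed '' 𝓑.e.far R')) →
      (∃ (b : Π x : 𝓑.carrier, TangentSpace (𝓡 4) x) (α : ℝ) (f : 𝓑.carrier → ℝ),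
        ContMDiffOn (𝓡 4) ((𝓡 4).prod 𝓘(ℝ, E4)) ∞
            (fun x ↦ (Bundle.TotalSpace.mk' E4 x (b x) : TangentBundle (𝓡 4) 𝓑.carrier)) 𝓑.doc ∧
        (∀ x ∈ 𝓑.doc, VectorField.mlieBracket (𝓡 4) 𝓑.killing b x = 0) ∧
        ContMDiffOn (𝓡 4) 𝓘(ℝ, ℝ) ∞ f 𝓑.doc ∧
        (∀ x ∈ 𝓑.doc, mfderiv (𝓡 4) 𝓘(ℝ, ℝ) f x (𝓑.killing x) = 0) ∧
        0 < α ∧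
        (∀ x ∈ stationaryOrbit 𝓑.killing S, (show ℝ from mfderiv (𝓡 4) 𝓘(ℝ, ℝ) f x (b x)) < 0) ∧
        ∀ x ∈ stationaryOrbit 𝓑.killing S, ∀ v : TangentSpace (𝓡 4) x,
          𝓑.metric.val x v (𝓑.killing x) = 0 → v ≠ 0 →
            (1 / 2 * LinearMap.trace ℝ (TangentSpace (𝓡 4) x) (𝓑.metric.leviCivita b x).toLinearMap
                - α) * 𝓑.metric.val x v v - 𝓑.metric.val x (𝓑.metric.leviCivita b x v) v < 0) →
      ∀ Z : Π x : 𝓑.carrier, TangentSpace (𝓡 4) x,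
        ContMDiffOn (𝓡 4) ((𝓡 4).prod 𝓘(ℝ, E4)) ∞
            (fun x ↦ (Bundle.TotalSpace.mk' E4 x (Z x) : TangentBundle (𝓡 4) 𝓑.carrier)) 𝓑.doc →
        (∀ x ∈ 𝓑.doc, VectorField.mlieBracket (𝓡 4) 𝓑.killing Z x = 0) →
        (∀ x ∈ 𝓑.doc, x ∉ stationaryOrbit 𝓑.killing S → ∀ v w : TangentSpace (𝓡 4) x,
          𝓑.metric.val x (𝓑.metric.leviCivita Z x v) w +
            𝓑.metric.val x v (𝓑.metric.leviCivita Z x w) = 0) →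
        ∃ Z' : Π x : 𝓑.carrier, TangentSpace (𝓡 4) x,
          ContMDiffOn (𝓡 4) ((𝓡 4).prod 𝓘(ℝ, E4)) ∞
              (fun x ↦ (Bundle.TotalSpace.mk' E4 x (Z' x) : TangentBundle (𝓡 4) 𝓑.carrier)) 𝓑.doc ∧
          (∀ x ∈ 𝓑.doc, ∀ v w : TangentSpace (𝓡 4) x,
            𝓑.metric.val x (𝓑.metric.leviCivita Z' x v) w +
              𝓑.metric.val x v (𝓑.metric.leviCivita Z' x w) = 0) ∧
          ∀ x ∈ stationaryOrbit 𝓑.killing (𝓑.embed '' 𝓑.e.far R'), Z' x = Z x) :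
    BeltLiouville.BeltKillingLiouville := by
  intro 𝓑 _ hvac hsc S R' hS hSd hR' hdisj hnt Z hZ hTZ hZK
  exact h₂ 𝓑 hvac hsc S R' hS hSd hR' hdisj (h₁ 𝓑 hvac S hS hSd hnt) Z hZ hTZ hZK

/-- **stub 3 — `stub_beltReduction` = the SHARED item `BeltLiouville.BeltReduction`
(stmt-FinalStateConjecture-10443, crux rank 3 of route BeltLiouville, vetted; NOT new mathematics of
this line — docking, as card dock-hawking-step-shared-crux and Disproof F5 recommend): per hole, the
belt Liouville property + collar + doc compact mod `T` + non-trapping mod `T` ⇒ the collar field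
extends to a `T`-commuting Killing field of the d.o.c.  Its own why-might-fail (poles / pole
component of `{T timelike}` / monodromy / cutoff margin) is recorded on that item.  Size: L. -/
theorem stub_beltReduction : BeltLiouville.BeltReduction := by
  sorry

/-- **The line proves the shared Hawking step `SmoothHawkingRigidity` (target stmt-10441 of
BeltLiouville; letter-identical in content to AIE's `NonTrappingHawkingRigidity` stmt-13896 modulo
telescope) BY NAME** from stubs 1–3.  Real proof (the `TargetOfCruxes` logic of BeltLiouville,
re-threaded through this line's two engine stubs). -/
theorem smoothHawkingRigidity_of
    (h₁₂ : BeltLiouville.BeltKillingLiouville) (h₃ : BeltLiouville.BeltReduction) :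
    BeltLiouville.SmoothHawkingRigidity := by
  intro 𝓑 _ hvac hsc U K κ hU hHU hconn hKs hKill hTK hne htan hκ hgeod hcomp hnt
  exact h₃ 𝓑 hvac hsc U K κ hU hHU hconn hKs hKill hTK hne htan hκ hgeod hcomp hnt
    (fun S R' hS hSd hR' hdisj hntS Z hZ hTZ hZK ↦
      h₁₂ 𝓑 hvac hsc S R' hS hSd hR' hdisj hntS Z hZ hTZ hZK)

/-! ## § 3  The restated crux this line presupposes, its dock-frame endgame, and the 4-stub composition -/

/-- **`ZeroEnergyRigidityRestated`** — the repair every surviving card presupposes (Disproof F5: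
non-trapping MOD THE FLOW + collar-local h3; TRIAGE-r1-3 / Disproof F7(i): `I⁺`-regularity as a
HYPOTHESIS; TRIAGE-r1-2: compact horizon sections are then available through the `I⁺`-regular
hypersurface).  Body: the telescope of `BeltLiouville.SmoothHawkingRigidity` VERBATIM (vacuum;
`π₁(doc) = 0`; collar `U ⊇ 𝓔⁺` with `K` smooth and Killing on `U`, `[T,K] = 0`, `K ≠ 0` and tangent on
the connected horizon, `∇_K K = κK`, `κ ≠ 0`; d.o.c. compact mod `T` via `(U₁, R', S)`; no maximal
zero-energy null geodesic trapped mod the flow) + `[Kerr.Facts]` + `𝓑.IsIPlusRegular` ⇒ the crux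
conclusion VERBATIM (∃ sub-extremal `(M, a)` and a smooth injective isometric immersion of the
Kerr–Schild exterior chart onto `doc`).  This is a PROPOSAL for the route planner's restate, not an
item; if filed with this body, `zeroEnergyRigidityRestated_of` below is the registrable `_of`. -/
def ZeroEnergyRigidityRestated : Prop :=
  ∀ (𝓑 : StationaryAFBlackHole.{0}) [𝓑.metric.HasLeviCivita] [Kerr.Facts],
    𝓑.metric.toPseudoRiemannianMetric.IsRicciFlat → 𝓑.IsIPlusRegular → SimplyConnectedSpace 𝓑.doc →
    ∀ (U : Set 𝓑.carrier) (K : Π x : 𝓑.carrier, TangentSpace (𝓡 4) x) (κ : ℝ),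
      IsOpen U → 𝓑.horizon ⊆ U → IsConnected 𝓑.horizon →
      ContMDiffOn (𝓡 4) ((𝓡 4).prod 𝓘(ℝ, E4)) ∞
          (fun x ↦ (Bundle.TotalSpace.mk' E4 x (K x) : TangentBundle (𝓡 4) 𝓑.carrier)) U →
      (∀ x ∈ U, ∀ v w : TangentSpace (𝓡 4) x,
        𝓑.metric.val x (𝓑.metric.leviCivita K x v) w +
          𝓑.metric.val x v (𝓑.metric.leviCivita K x w) = 0) →
      (∀ x ∈ U, VectorField.mlieBracket (𝓡 4) 𝓑.killing K x = 0) →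
      (∀ p ∈ 𝓑.horizon, K p ≠ 0) →
      (∀ γ : ℝ → 𝓑.carrier, IsMIntegralCurve γ K → γ 0 ∈ 𝓑.horizon → ∀ t, γ t ∈ 𝓑.horizon) →
      κ ≠ 0 → (∀ p ∈ 𝓑.horizon, 𝓑.metric.leviCivita K p (K p) = κ • K p) →
      (∃ (U₁ : Set 𝓑.carrier) (R' : ℝ) (S : Set 𝓑.carrier), IsOpen U₁ ∧ 𝓑.horizon ⊆ U₁ ∧
        closure U₁ ⊆ U ∧ 𝓑.e.R + 1 ≤ R' ∧ IsCompact S ∧ S ⊆ 𝓑.doc ∧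
          Disjoint (stationaryOrbit 𝓑.killing S)
            (stationaryOrbit 𝓑.killing (𝓑.embed '' 𝓑.e.far (R' + 1))) ∧
          ∀ x ∈ 𝓑.doc, x ∉ U₁ → x ∉ (stationaryOrbit 𝓑.killing (𝓑.embed '' 𝓑.e.far R')) →
            x ∈ stationaryOrbit 𝓑.killing S) →
      (∀ S : Set 𝓑.carrier, IsCompact S → S ⊆ 𝓑.doc →
        ∀ (γ : ℝ → 𝓑.carrier) (s : Set ℝ),
          IsMaximalGeodesicOn 𝓑.metric.toPseudoRiemannianMetric.leviCivita γ s → s.Nonempty →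
            (∀ t ∈ s, 𝓑.metric.val (γ t) (velocity (𝓡 4) γ t) (velocity (𝓡 4) γ t) = 0 ∧
              velocity (𝓡 4) γ t ≠ 0 ∧
                𝓑.metric.val (γ t) (velocity (𝓡 4) γ t) (𝓑.killing (γ t)) = 0) →
            ∃ t ∈ s, γ t ∉ stationaryOrbit 𝓑.killing S) →
      ∃ (M a : ℝ), Kerr.IsSubextremal M a ∧ ∃ Ψ : Kerr.exterior M a → 𝓑.carrier,
        Function.Injective Ψ ∧ Set.range Ψ = 𝓑.doc ∧
          PseudoRiemannianMetric.IsIsometricImmersion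
            (Kerr.smoothMetric M a (Kerr.rPlus M a)).toPseudoRiemannianMetric
            𝓑.metric.toPseudoRiemannianMetric Ψ

/-- **stub 4 — `stub_axisymmetricEndgame` (dock frame (T3), SHARED with card
dock-hawking-step-shared-crux; known modulo vendoring + presentation surgery).**  A vacuum,
`I⁺`-regular 𝓑 with connected horizon carrying a non-degenerate `T`-commuting Killing collar
`(U, K, κ)` whose collar field extends to `K'` Killing on the d.o.c., `[T, K'] = 0`, `K' = K` near
`𝓔⁺`, has d.o.c. a sub-extremal Kerr exterior (chart form).
Intended proof: `K' ∈ ℝT` near `𝓔⁺` ⇒ `T` generates the horizon ⇒ Sudarsky–Wald/Chruściel–Wald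
staticity ⇒ `ChruscielGalloway2010_staticUniqueness` ⇒ Schwarzschild = Kerr `a = 0`; otherwise
Beig–Chruściel (CMP 188 (1997) Thm 1.2; positive mass on the `I⁺`-regular hypersurface) gives a
periodic combination `Y` of `T, K'` with an axis, `[T, Y] = 0`; apply
`ChruscielCostaHeusler2012_axisymmetricUniqueness.apply` to the sub-presentation with carrier
`doc ∪ U'` (on which `Y` is global; `doc` is causally convex so its d.o.c./horizon are unchanged —
Disproof F7(iii): nothing is claimed about the interior), with `hF hP hres` the PROVED instances
`isOpen_chronologicalFuture/Past_holds_of_boundaryless`, `contMDiff_restrict_holds`; transfer the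
`Diffeomorph`-isometry `IsIsometricToKerrExterior` to the injective-immersion chart form.
Why it might fail: only as formalisation debt (Beig–Chruściel and the staticity theorem are not
vendored; the sub-presentation must be shown `I⁺`-regular); mathematically LRR 1205.6112 Thm 3.2 +
§3.3.1.  Size: L (maths) / XL (Lean).  Sources: ChruscielCostaHeusler2012 Thm 3.2, ChruscielCosta2008
§§5–7, Beig–Chruściel 1997, SudarskyWald1992, ChruscielWald1994, ChruscielGalloway2010. -/
theorem stub_axisymmetricEndgame :
    ∀ (𝓑 : StationaryAFBlackHole.{0}) [𝓑.metric.HasLeviCivita] [Kerr.Facts],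
      𝓑.metric.toPseudoRiemannianMetric.IsRicciFlat → 𝓑.IsIPlusRegular → IsConnected 𝓑.horizon →
      ∀ (U : Set 𝓑.carrier) (K : Π x : 𝓑.carrier, TangentSpace (𝓡 4) x) (κ : ℝ),
        IsOpen U → 𝓑.horizon ⊆ U →
        ContMDiffOn (𝓡 4) ((𝓡 4).prod 𝓘(ℝ, E4)) ∞
            (fun x ↦ (Bundle.TotalSpace.mk' E4 x (K x) : TangentBundle (𝓡 4) 𝓑.carrier)) U →
        (∀ x ∈ U, ∀ v w : TangentSpace (𝓡 4) x,
          𝓑.metric.val x (𝓑.metric.leviCivita K x v) w +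
            𝓑.metric.val x v (𝓑.metric.leviCivita K x w) = 0) →
        (∀ x ∈ U, VectorField.mlieBracket (𝓡 4) 𝓑.killing K x = 0) →
        (∀ p ∈ 𝓑.horizon, K p ≠ 0) →
        (∀ γ : ℝ → 𝓑.carrier, IsMIntegralCurve γ K → γ 0 ∈ 𝓑.horizon → ∀ t, γ t ∈ 𝓑.horizon) →
        κ ≠ 0 → (∀ p ∈ 𝓑.horizon, 𝓑.metric.leviCivita K p (K p) = κ • K p) →
        (∃ K' : Π x : 𝓑.carrier, TangentSpace (𝓡 4) x,
          ContMDiffOn (𝓡 4) ((𝓡 4).prod 𝓘(ℝ, E4)) ∞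
              (fun x ↦ (Bundle.TotalSpace.mk' E4 x (K' x) : TangentBundle (𝓡 4) 𝓑.carrier)) 𝓑.doc ∧
          (∀ x ∈ 𝓑.doc, ∀ v w : TangentSpace (𝓡 4) x,
            𝓑.metric.val x (𝓑.metric.leviCivita K' x v) w +
              𝓑.metric.val x v (𝓑.metric.leviCivita K' x w) = 0) ∧
          (∀ x ∈ 𝓑.doc, VectorField.mlieBracket (𝓡 4) 𝓑.killing K' x = 0) ∧
          ∃ U' : Set 𝓑.carrier, IsOpen U' ∧ 𝓑.horizon ⊆ U' ∧ ∀ x ∈ U' ∩ 𝓑.doc, K' x = K x) →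
        ∃ (M a : ℝ), Kerr.IsSubextremal M a ∧ ∃ Ψ : Kerr.exterior M a → 𝓑.carrier,
          Function.Injective Ψ ∧ Set.range Ψ = 𝓑.doc ∧
            PseudoRiemannianMetric.IsIsometricImmersion
              (Kerr.smoothMetric M a (Kerr.rPlus M a)).toPseudoRiemannianMetric
              𝓑.metric.toPseudoRiemannianMetric Ψ := by
  sorry

/-- **The 4-stub composition for the RESTATED crux** (real proof): geometry (stub 1) + engine
(stub 2) give `BeltKillingLiouville`; the shared reduction (stub 3) gives the Hawking step
`SmoothHawkingRigidity`; the dock-frame endgame (stub 4) closes.  If the route planner files the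
restate with the body of `ZeroEnergyRigidityRestated`, this theorem (retargeted to the new decl,
definitionally equal) is the line's `<Crux>_of`, registrable by `ledger skeleton check`. -/
theorem zeroEnergyRigidityRestated_of
    (h₁₂ : BeltLiouville.BeltKillingLiouville) (h₃ : BeltLiouville.BeltReduction)
    (h₄ : ∀ (𝓑 : StationaryAFBlackHole.{0}) [𝓑.metric.HasLeviCivita] [Kerr.Facts],
      𝓑.metric.toPseudoRiemannianMetric.IsRicciFlat → 𝓑.IsIPlusRegular → IsConnected 𝓑.horizon →
      ∀ (U : Set 𝓑.carrier) (K : Π x : 𝓑.carrier, TangentSpace (𝓡 4) x) (κ : ℝ),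
        IsOpen U → 𝓑.horizon ⊆ U →
        ContMDiffOn (𝓡 4) ((𝓡 4).prod 𝓘(ℝ, E4)) ∞
            (fun x ↦ (Bundle.TotalSpace.mk' E4 x (K x) : TangentBundle (𝓡 4) 𝓑.carrier)) U →
        (∀ x ∈ U, ∀ v w : TangentSpace (𝓡 4) x,
          𝓑.metric.val x (𝓑.metric.leviCivita K x v) w +
            𝓑.metric.val x v (𝓑.metric.leviCivita K x w) = 0) →
        (∀ x ∈ U, VectorField.mlieBracket (𝓡 4) 𝓑.killing K x = 0) →
        (∀ p ∈ 𝓑.horizon, K p ≠ 0) →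
        (∀ γ : ℝ → 𝓑.carrier, IsMIntegralCurve γ K → γ 0 ∈ 𝓑.horizon → ∀ t, γ t ∈ 𝓑.horizon) →
        κ ≠ 0 → (∀ p ∈ 𝓑.horizon, 𝓑.metric.leviCivita K p (K p) = κ • K p) →
        (∃ K' : Π x : 𝓑.carrier, TangentSpace (𝓡 4) x,
          ContMDiffOn (𝓡 4) ((𝓡 4).prod 𝓘(ℝ, E4)) ∞
              (fun x ↦ (Bundle.TotalSpace.mk' E4 x (K' x) : TangentBundle (𝓡 4) 𝓑.carrier)) 𝓑.doc ∧
          (∀ x ∈ 𝓑.doc, ∀ v w : TangentSpace (𝓡 4) x,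
            𝓑.metric.val x (𝓑.metric.leviCivita K' x v) w +
              𝓑.metric.val x v (𝓑.metric.leviCivita K' x w) = 0) ∧
          (∀ x ∈ 𝓑.doc, VectorField.mlieBracket (𝓡 4) 𝓑.killing K' x = 0) ∧
          ∃ U' : Set 𝓑.carrier, IsOpen U' ∧ 𝓑.horizon ⊆ U' ∧ ∀ x ∈ U' ∩ 𝓑.doc, K' x = K x) →
        ∃ (M a : ℝ), Kerr.IsSubextremal M a ∧ ∃ Ψ : Kerr.exterior M a → 𝓑.carrier,
          Function.Injective Ψ ∧ Set.range Ψ = 𝓑.doc ∧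
            PseudoRiemannianMetric.IsIsometricImmersion
              (Kerr.smoothMetric M a (Kerr.rPlus M a)).toPseudoRiemannianMetric
              𝓑.metric.toPseudoRiemannianMetric Ψ) :
    ZeroEnergyRigidityRestated := by
  intro 𝓑 _ _ hvac hreg hsc U K κ hU hHU hconn hKs hKill hTK hne htan hκ hgeod hcomp hnt
  exact h₄ 𝓑 hvac hreg hconn U K κ hU hHU hKs hKill hTK hne htan hκ hgeod
    (smoothHawkingRigidity_of h₁₂ h₃ 𝓑 hvac hsc U K κ hU hHU hconn hKs hKill hTK hne htan hκ hgeod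
      hcomp hnt)

/-- The same composition spelled out from the four `stub_*` statements (so that a registrant sees
the exact hypothesis list): stub 1 → stub 2 → stub 3 → stub 4 → `ZeroEnergyRigidityRestated`. -/
theorem zeroEnergyRigidityRestated_of_stubs : ZeroEnergyRigidityRestated :=
  zeroEnergyRigidityRestated_of
    (beltKillingLiouville_of stub_pairFromNonTrapping stub_pairKillingLiouville)
    stub_beltReduction stub_axisymmetricEndgame

/-- **Adoption helper for the crux chain of stmt-10442** (`BeltLiouville.BeltKillingLiouville`):
the `<Crux>_of` shape that `ledger skeleton check --crux stmt-FinalStateConjecture-10442` expects,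
with the two engine stubs as the only hypotheses (this seat cannot register on that item; its
planner/lead may copy § 1 + this theorem verbatim). -/
theorem BeltKillingLiouville_of :
    (∀ (𝓑 : StationaryAFBlackHole.{0}) [𝓑.metric.HasLeviCivita],
      𝓑.metric.toPseudoRiemannianMetric.IsRicciFlat →
      ∀ (S : Set 𝓑.carrier), IsCompact S → S ⊆ 𝓑.doc →
      (∀ (γ : ℝ → 𝓑.carrier) (s : Set ℝ),
        IsMaximalGeodesicOn 𝓑.metric.toPseudoRiemannianMetric.leviCivita γ s → s.Nonempty →
          (∀ t ∈ s, 𝓑.metric.val (γ t) (velocity (𝓡 4) γ t) (velocity (𝓡 4) γ t) = 0 ∧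
            velocity (𝓡 4) γ t ≠ 0 ∧
              𝓑.metric.val (γ t) (velocity (𝓡 4) γ t) (𝓑.killing (γ t)) = 0) →
          ∃ t ∈ s, γ t ∉ stationaryOrbit 𝓑.killing S) →
      ∃ (b : Π x : 𝓑.carrier, TangentSpace (𝓡 4) x) (α : ℝ) (f : 𝓑.carrier → ℝ),
        ContMDiffOn (𝓡 4) ((𝓡 4).prod 𝓘(ℝ, E4)) ∞
            (fun x ↦ (Bundle.TotalSpace.mk' E4 x (b x) : TangentBundle (𝓡 4) 𝓑.carrier)) 𝓑.doc ∧
        (∀ x ∈ 𝓑.doc, VectorField.mlieBracket (𝓡 4) 𝓑.killing b x = 0) ∧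
        ContMDiffOn (𝓡 4) 𝓘(ℝ, ℝ) ∞ f 𝓑.doc ∧
        (∀ x ∈ 𝓑.doc, mfderiv (𝓡 4) 𝓘(ℝ, ℝ) f x (𝓑.killing x) = 0) ∧
        0 < α ∧
        (∀ x ∈ stationaryOrbit 𝓑.killing S, (show ℝ from mfderiv (𝓡 4) 𝓘(ℝ, ℝ) f x (b x)) < 0) ∧
        ∀ x ∈ stationaryOrbit 𝓑.killing S, ∀ v : TangentSpace (𝓡 4) x,
          𝓑.metric.val x v (𝓑.killing x) = 0 → v ≠ 0 →
            (1 / 2 * LinearMap.trace ℝ (TangentSpace (𝓡 4) x) (𝓑.metric.leviCivita b x).toLinearMap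
                - α) * 𝓑.metric.val x v v - 𝓑.metric.val x (𝓑.metric.leviCivita b x v) v < 0) →
    (∀ (𝓑 : StationaryAFBlackHole.{0}) [𝓑.metric.HasLeviCivita],
      𝓑.metric.toPseudoRiemannianMetric.IsRicciFlat → SimplyConnectedSpace 𝓑.doc →
      ∀ (S : Set 𝓑.carrier) (R' : ℝ), IsCompact S → S ⊆ 𝓑.doc → 𝓑.e.R + 1 ≤ R' →
      Disjoint (stationaryOrbit 𝓑.killing S) (stationaryOrbit 𝓑.killing (𝓑.embed '' 𝓑.e.far R')) →
      (∃ (b : Π x : 𝓑.carrier, TangentSpace (𝓡 4) x) (α : ℝ) (f : 𝓑.carrier → ℝ),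
        ContMDiffOn (𝓡 4) ((𝓡 4).prod 𝓘(ℝ, E4)) ∞
            (fun x ↦ (Bundle.TotalSpace.mk' E4 x (b x) : TangentBundle (𝓡 4) 𝓑.carrier)) 𝓑.doc ∧
        (∀ x ∈ 𝓑.doc, VectorField.mlieBracket (𝓡 4) 𝓑.killing b x = 0) ∧
        ContMDiffOn (𝓡 4) 𝓘(ℝ, ℝ) ∞ f 𝓑.doc ∧
        (∀ x ∈ 𝓑.doc, mfderiv (𝓡 4) 𝓘(ℝ, ℝ) f x (𝓑.killing x) = 0) ∧
        0 < α ∧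
        (∀ x ∈ stationaryOrbit 𝓑.killing S, (show ℝ from mfderiv (𝓡 4) 𝓘(ℝ, ℝ) f x (b x)) < 0) ∧
        ∀ x ∈ stationaryOrbit 𝓑.killing S, ∀ v : TangentSpace (𝓡 4) x,
          𝓑.metric.val x v (𝓑.killing x) = 0 → v ≠ 0 →
            (1 / 2 * LinearMap.trace ℝ (TangentSpace (𝓡 4) x) (𝓑.metric.leviCivita b x).toLinearMap
                - α) * 𝓑.metric.val x v v - 𝓑.metric.val x (𝓑.metric.leviCivita b x v) v < 0) →
      ∀ Z : Π x : 𝓑.carrier, TangentSpace (𝓡 4) x,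
        ContMDiffOn (𝓡 4) ((𝓡 4).prod 𝓘(ℝ, E4)) ∞
            (fun x ↦ (Bundle.TotalSpace.mk' E4 x (Z x) : TangentBundle (𝓡 4) 𝓑.carrier)) 𝓑.doc →
        (∀ x ∈ 𝓑.doc, VectorField.mlieBracket (𝓡 4) 𝓑.killing Z x = 0) →
        (∀ x ∈ 𝓑.doc, x ∉ stationaryOrbit 𝓑.killing S → ∀ v w : TangentSpace (𝓡 4) x,
          𝓑.metric.val x (𝓑.metric.leviCivita Z x v) w +
            𝓑.metric.val x v (𝓑.metric.leviCivita Z x w) = 0) →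
        ∃ Z' : Π x : 𝓑.carrier, TangentSpace (𝓡 4) x,
          ContMDiffOn (𝓡 4) ((𝓡 4).prod 𝓘(ℝ, E4)) ∞
              (fun x ↦ (Bundle.TotalSpace.mk' E4 x (Z' x) : TangentBundle (𝓡 4) 𝓑.carrier)) 𝓑.doc ∧
          (∀ x ∈ 𝓑.doc, ∀ v w : TangentSpace (𝓡 4) x,
            𝓑.metric.val x (𝓑.metric.leviCivita Z' x v) w +
              𝓑.metric.val x v (𝓑.metric.leviCivita Z' x w) = 0) ∧
          ∀ x ∈ stationaryOrbit 𝓑.killing (𝓑.embed '' 𝓑.e.far R'), Z' x = Z x) →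
    BeltLiouville.BeltKillingLiouville :=
  fun h₁ h₂ ↦ beltKillingLiouville_of h₁ h₂

/-- **Adoption helper for stmt-10441** (`BeltLiouville.SmoothHawkingRigidity`): by-name
composition from `BeltKillingLiouville` (itself from stubs 1–2) and the shared stub 3. -/
theorem SmoothHawkingRigidity_of :
    BeltLiouville.BeltKillingLiouville → BeltLiouville.BeltReduction →
      BeltLiouville.SmoothHawkingRigidity :=
  fun h₁₂ h₃ ↦ smoothHawkingRigidity_of h₁₂ h₃

/-! ## § 4  The typed decl: the exact residue, and why it is not a stub -/

/-- **`TypedTelescopeGap`** — what a `ZeroEnergyRigidity_of` built on this line would have to add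
as a stub: the typed hypotheses h1–h4 (h5, h6 are decoration/void: Disproof F8, F2) must SUPPLY the
restated telescope.  Conjunct by conjunct:
* `IsIPlusRegular 𝓑` from h1–h4: FALSE (Disproof F7(i); TRIAGE-r1-3 F-A; band-Kerr of r1-2);
* `SimplyConnectedSpace doc`: plausible (topological censorship) but printed only under 𝓘-type
  hypotheses (ChruscielWald1994 Thm 2.3), unvendored;
* a `T`-COMMUTING collar from h3's global `K`: a genuine lemma (`[T,K]` is Killing, tangent, and in
  the rotating case killed by uniqueness of the `κ`-normalised null Killing generator), fine;
* d.o.c. compact mod `T`: part of the `I⁺`-regularity problem, open;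
* **non-trapping MOD THE FLOW from h1–h4: the conclusion's shadow** — no mechanism short of
  uniqueness itself (IK normalisation test), i.e. assuming what is to be proved in a weaker costume.
Hence this `def` is documentation, NOT a `stub_*`, and the line has no concluding skeleton on the
typed decl. -/
def TypedTelescopeGap : Prop :=
  ∀ (𝓑 : StationaryAFBlackHole.{0}) [𝓑.metric.HasLeviCivita] [Kerr.Facts],
    𝓑.metric.toPseudoRiemannianMetric.IsRicciFlat → IsConnected 𝓑.horizon →
    𝓑.toSpacetime.IsNonDegenerateHorizon 𝓑.Mext →
    𝓑.metric.IsGloballyHyperbolic 𝓑.timeOrientation →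
    𝓑.IsIPlusRegular ∧ SimplyConnectedSpace 𝓑.doc ∧
    ∃ (U : Set 𝓑.carrier) (K : Π x : 𝓑.carrier, TangentSpace (𝓡 4) x) (κ : ℝ),
      IsOpen U ∧ 𝓑.horizon ⊆ U ∧
      ContMDiffOn (𝓡 4) ((𝓡 4).prod 𝓘(ℝ, E4)) ∞
          (fun x ↦ (Bundle.TotalSpace.mk' E4 x (K x) : TangentBundle (𝓡 4) 𝓑.carrier)) U ∧
      (∀ x ∈ U, ∀ v w : TangentSpace (𝓡 4) x,
        𝓑.metric.val x (𝓑.metric.leviCivita K x v) w +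
          𝓑.metric.val x v (𝓑.metric.leviCivita K x w) = 0) ∧
      (∀ x ∈ U, VectorField.mlieBracket (𝓡 4) 𝓑.killing K x = 0) ∧
      (∀ p ∈ 𝓑.horizon, K p ≠ 0) ∧
      (∀ γ : ℝ → 𝓑.carrier, IsMIntegralCurve γ K → γ 0 ∈ 𝓑.horizon → ∀ t, γ t ∈ 𝓑.horizon) ∧
      κ ≠ 0 ∧ (∀ p ∈ 𝓑.horizon, 𝓑.metric.leviCivita K p (K p) = κ • K p) ∧
      (∃ (U₁ : Set 𝓑.carrier) (R' : ℝ) (S : Set 𝓑.carrier), IsOpen U₁ ∧ 𝓑.horizon ⊆ U₁ ∧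
        closure U₁ ⊆ U ∧ 𝓑.e.R + 1 ≤ R' ∧ IsCompact S ∧ S ⊆ 𝓑.doc ∧
          Disjoint (stationaryOrbit 𝓑.killing S)
            (stationaryOrbit 𝓑.killing (𝓑.embed '' 𝓑.e.far (R' + 1))) ∧
          ∀ x ∈ 𝓑.doc, x ∉ U₁ → x ∉ (stationaryOrbit 𝓑.killing (𝓑.embed '' 𝓑.e.far R')) →
            x ∈ stationaryOrbit 𝓑.killing S) ∧
      (∀ S : Set 𝓑.carrier, IsCompact S → S ⊆ 𝓑.doc →
        ∀ (γ : ℝ → 𝓑.carrier) (s : Set ℝ),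
          IsMaximalGeodesicOn 𝓑.metric.toPseudoRiemannianMetric.leviCivita γ s → s.Nonempty →
            (∀ t ∈ s, 𝓑.metric.val (γ t) (velocity (𝓡 4) γ t) (velocity (𝓡 4) γ t) = 0 ∧
              velocity (𝓡 4) γ t ≠ 0 ∧
                𝓑.metric.val (γ t) (velocity (𝓡 4) γ t) (𝓑.killing (γ t)) = 0) →
            ∃ t ∈ s, γ t ∉ stationaryOrbit 𝓑.killing S)

/-- **Kernel-checked witness of the verdict**: the typed crux follows from the restated one
EXACTLY through `TypedTelescopeGap` (pure logic; h5, h6 unused, as Disproof F8/F2 predict).  Since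
the gap is not a legitimate stub (docstring of `TypedTelescopeGap`), the line has no concluding
skeleton on `ZeroEnergyKerrOrBomb.ZeroEnergyRigidity` as typed. -/
theorem zeroEnergyRigidity_of_gap (hgap : TypedTelescopeGap) (hR : ZeroEnergyRigidityRestated) :
    ZeroEnergyKerrOrBomb.ZeroEnergyRigidity := by
  intro 𝓑 _ _ h1 h2 h3 h4 _h5 _h6
  obtain ⟨hreg, hsc, U, K, κ, hU, hHU, hKs, hKill, hTK, hne, htan, hκ, hgeod, hcomp, hnt⟩ :=
    hgap 𝓑 h1 h2 h3 h4
  exact hR 𝓑 h1 hreg hsc U K κ hU hHU h2 hKs hKill hTK hne htan hκ hgeod hcomp hnt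

/-! ## § 5  Litmus statements for the lead's first hour (no `sorry`; not stubs) -/

/-- **`ScalarPairLiouville`** — the card's first lemma (exact scalar model; TRUE by the multiplier
identity once integration on the orbit space is available): on the d.o.c. of a stationary AF black
hole, a smooth `T`-invariant solution of `□_g ψ = 0` supported in `orbit_T(S)`, `S` compact, with an
escape Pohozaev pair on `orbit_T(S)`, vanishes.  Size M as mathematics (identity + compact support
mod `T`); blocked in Lean only by the missing orbit-space integration API. -/
def ScalarPairLiouville : Prop :=
  ∀ (𝓑 : StationaryAFBlackHole.{0}) [𝓑.metric.HasLeviCivita] (S : Set 𝓑.carrier),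
    IsCompact S → S ⊆ 𝓑.doc →
    (∃ (b : Π x : 𝓑.carrier, TangentSpace (𝓡 4) x) (α : ℝ) (f : 𝓑.carrier → ℝ),
      IsEscapePair 𝓑 (stationaryOrbit 𝓑.killing S) b α f) →
    ∀ ψ : 𝓑.carrier → ℝ, ContMDiffOn (𝓡 4) 𝓘(ℝ, ℝ) ∞ ψ 𝓑.doc →
      (∀ x ∈ 𝓑.doc, 𝓑.metric.dalembertian ψ x = 0 ∧
        mfderiv (𝓡 4) 𝓘(ℝ, ℝ) ψ x (𝓑.killing x) = 0) →
      (∀ x ∈ 𝓑.doc, x ∉ stationaryOrbit 𝓑.killing S → ψ x = 0) →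
      ∀ x ∈ 𝓑.doc, ψ x = 0

/-- **`ScalarPairLiouvilleWithLowerOrder`** — the CHEAPEST FALSIFIER of the engine (G2): the same
with arbitrary smooth `T`-invariant first- and zeroth-order terms `X(ψ) + V ψ` added.  The weight-free
identity then acquires the unsigned cross terms `∫(bψ + αψ)(X(ψ) + Vψ)` — exactly the tensorial
difficulty in scalar costume.  If this is FALSE (a compactly-supported-mod-`T` solution of a
perturbed reduced equation over a region carrying a pair), the weight-free engine is dead for
systems and the line falls back to gradient pairs + Carleman (= the route's planned child
`CarlemanSweep`); if TRUE by a weight-free argument, G2 is answered.  Decide this first. -/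
def ScalarPairLiouvilleWithLowerOrder : Prop :=
  ∀ (𝓑 : StationaryAFBlackHole.{0}) [𝓑.metric.HasLeviCivita] (S : Set 𝓑.carrier),
    IsCompact S → S ⊆ 𝓑.doc →
    (∃ (b : Π x : 𝓑.carrier, TangentSpace (𝓡 4) x) (α : ℝ) (f : 𝓑.carrier → ℝ),
      IsEscapePair 𝓑 (stationaryOrbit 𝓑.killing S) b α f) →
    ∀ (V : 𝓑.carrier → ℝ) (X : Π x : 𝓑.carrier, TangentSpace (𝓡 4) x),
      ContMDiffOn (𝓡 4) 𝓘(ℝ, ℝ) ∞ V 𝓑.doc →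
      ContMDiffOn (𝓡 4) ((𝓡 4).prod 𝓘(ℝ, E4)) ∞
          (fun x ↦ (Bundle.TotalSpace.mk' E4 x (X x) : TangentBundle (𝓡 4) 𝓑.carrier)) 𝓑.doc →
      (∀ x ∈ 𝓑.doc, mfderiv (𝓡 4) 𝓘(ℝ, ℝ) V x (𝓑.killing x) = 0 ∧
        VectorField.mlieBracket (𝓡 4) 𝓑.killing X x = 0) →
    ∀ ψ : 𝓑.carrier → ℝ, ContMDiffOn (𝓡 4) 𝓘(ℝ, ℝ) ∞ ψ 𝓑.doc →
      (∀ x ∈ 𝓑.doc,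
        𝓑.metric.dalembertian ψ x + (show ℝ from mfderiv (𝓡 4) 𝓘(ℝ, ℝ) ψ x (X x)) + V x * ψ x = 0 ∧
          mfderiv (𝓡 4) 𝓘(ℝ, ℝ) ψ x (𝓑.killing x) = 0) →
      (∀ x ∈ 𝓑.doc, x ∉ stationaryOrbit 𝓑.killing S → ψ x = 0) →
      ∀ x ∈ 𝓑.doc, ψ x = 0

end Summit.FinalStateConjecture.FinalStateConjecture.Cruxes.ZeroEnergyRigidity.ZeroFrequencyPohozaevPair

end
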